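import Mathlib
import Literature.NumberTheory.Transcendental.KZLogCalculusProofs
import Literature.NumberTheory.Transcendental.KZDominatedFamilyRelations
import Literature.NumberTheory.Transcendental.KZCubicalCalculus
import Summits.KontsevichZagierPeriods.KontsevichZagierPeriods.Theses.InverseLandau
import Summits.KontsevichZagierPeriods.KontsevichZagierPeriods.Theorems.FurushoPentagonPentagonInKZSimplexToCube

/-!
# `TateFamilyKernel` — reduction of the open-cube fibre to the tame closed-cube fibre

Crux `TateFamilyKernel` (stmt-KontsevichZagierPeriods-9130, route `InverseLandau`). The crux
quantifies over every honest representation `r` whose domain is the OPEN unit cube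
`∏ᵢ (0,1)` and whose integrand agrees there with the fibre `z ↦ P(z,ϖ₀)/Q(z,ϖ₀)`. Every certificate
of the line is built on CLOSED cubes (tame cubes of `KZCubicalCalculus.lean`). This file supplies the
bridge: if a function `f`, analytic near `[0,1]ⁿ` and `ℚ`-semialgebraic on it, has its tame cube
representation `[[0,1]ⁿ, f]` in `KZ.relations`, then so does every `r` with domain `(0,1)ⁿ` and
integrand `= f` on `(0,1)ⁿ` (rule (1): the faces are null, `KZ.IntegralRep.of_sub_of_restrict_mem_relations`;
congruence `KZ.of_sub_of_mem_relations_of_eqOn`). The nullity of the faces is the tree's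
`volume_cube_diff_openUnitCube` (file `FurushoPentagonPentagonInKZSimplexToCube.lean`).
-/

noncomputable section

open MeasureTheory Set
open Literature.NumberTheory.Transcendental
open Literature.ModelTheory.ExponentialFields (IsSemialgebraic)
open Summit.KontsevichZagierPeriods.FurushoPentagon.PentagonInKZ.SimplexToCube
  (volume_cube_diff_openUnitCube)

namespace Summit.KontsevichZagierPeriods.InverseLandau.TateFamilyKernel

/-- The open unit cube written as `Set.pi univ (0,1)` (the crux's spelling) is `openUnitCube n`.
[folklore] -/
theorem pi_univ_Ioo_eq_openUnitCube (n : ℕ) :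
    (Set.pi Set.univ fun _ : Fin n => Set.Ioo (0 : ℝ) 1) = openUnitCube n := by
  ext x
  simp [mem_openUnitCube_iff, Set.mem_pi]

/-- **Open cube versus closed cube.** For a representation `R` whose domain is the closed unit cube
and any honest representation `r` with domain the open cube `∏ᵢ (0,1)` whose integrand agrees with
`R`'s there, `[R] − [r] ∈ KZ.relations` (domain additivity across the null faces,
`KZ.IntegralRep.of_sub_of_restrict_mem_relations`, then congruence of integrands on the common
domain, `KZ.of_sub_of_mem_relations_of_eqOn`). [cite: KontsevichZagier2001, §1.2] -/
theorem of_sub_of_mem_relations_of_domain_eq_cube {n : ℕ} (R r : KZ.IntegralRep n)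
    (hR : R.domain = KZ.cube n) (hd : r.domain = Set.pi Set.univ fun _ : Fin n => Set.Ioo (0 : ℝ) 1)
    (hi : EqOn r.integrand R.integrand r.domain) :
    KZ.of R - KZ.of r ∈ KZ.relations := by
  rw [pi_univ_Ioo_eq_openUnitCube] at hd
  have hE : IsSemialgebraic ℚ (openUnitCube n) := isSemialgebraic_openUnitCube
  have hEsub : openUnitCube n ⊆ R.domain := by
    rw [hR]
    exact KZ.openUnitCube_subset_cube
  have hvol : volume (R.domain \ openUnitCube n) = 0 := by
    rw [hR]
    exact volume_cube_diff_openUnitCube n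
  have h1 : KZ.of R - KZ.of (R.restrict _ hE hEsub) ∈ KZ.relations :=
    KZ.IntegralRep.of_sub_of_restrict_mem_relations R hE hEsub hvol
  have h2 : KZ.of (R.restrict _ hE hEsub) - KZ.of r ∈ KZ.relations :=
    KZ.of_sub_of_mem_relations_of_eqOn (by rw [hd]; rfl) fun x hx => by
      have hx' : x ∈ r.domain := by rw [hd]; exact hx
      simpa using (hi hx').symm
  have : KZ.of R - KZ.of r = (KZ.of R - KZ.of (R.restrict _ hE hEsub)) +
      (KZ.of (R.restrict _ hE hEsub) - KZ.of r) := by abel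
  rw [this]
  exact KZ.relations.add_mem h1 h2

/-- **Open cube from tame cube.** If a tame cube representation `R = [[0,1]ⁿ, f]` lies in
`KZ.relations`, then so does every honest representation with domain the open cube `∏ᵢ (0,1)` and
integrand `= f` there. [cite: KontsevichZagier2001, §1.2] -/
theorem of_mem_relations_of_isTameCube {n : ℕ} {R : KZ.IntegralRep n} (hR : R.IsTameCube)
    (h : KZ.of R ∈ KZ.relations) (r : KZ.IntegralRep n)
    (hd : r.domain = Set.pi Set.univ fun _ : Fin n => Set.Ioo (0 : ℝ) 1)
    (hi : EqOn r.integrand R.integrand r.domain) :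
    KZ.of r ∈ KZ.relations := by
  have h' := of_sub_of_mem_relations_of_domain_eq_cube R r hR.domain_eq hd hi
  have : KZ.of r = KZ.of R - (KZ.of R - KZ.of r) := by abel
  rw [this]
  exact KZ.relations.sub_mem h h'

/-- **Open cube from tame cube**, for the packaged representation `KZ.IntegralRep.tameCube f`.
[cite: KontsevichZagier2001, §1.2] -/
theorem of_mem_relations_of_tameCube {n : ℕ} {f : (Fin n → ℝ) → ℝ}
    (hf : AnalyticOnNhd ℝ f (KZ.cube n)) (hsa : IsSemialgebraicFunOn ℚ (KZ.cube n) f)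
    (h : KZ.of (KZ.IntegralRep.tameCube f hf hsa) ∈ KZ.relations)
    (r : KZ.IntegralRep n) (hd : r.domain = Set.pi Set.univ fun _ : Fin n => Set.Ioo (0 : ℝ) 1)
    (hi : EqOn r.integrand f r.domain) :
    KZ.of r ∈ KZ.relations :=
  of_mem_relations_of_isTameCube (KZ.IntegralRep.isTameCube_tameCube f hf hsa) h r hd hi

end Summit.KontsevichZagierPeriods.InverseLandau.TateFamilyKernel
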